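import Summits.RiemannHypothesis.RiemannHypothesis.Theses.LiDirichletEcho
import Summits.RiemannHypothesis.RiemannHypothesis.Theorems.LiPrimeEchoHorizontalEdges
import Literature.NumberTheory.LFunctions.DirichletLZeroCounting
import HarnessLib

/-!
# RiemannHypothesis / LiDirichletEcho — crux K3χ `LiHorizontalEdgesChar`: the horizontal edges of `L(s, χ)` at GOOD
# heights (RH-FREE, GRH-FREE)

RH-FREE · GRH-FREE [rh-li-eng g5, acting as prover on the unstaffed route].  Route `Theses/LiDirichletEcho.lean` (rung
«Li PRIME-ECHO LAW FOR DIRICHLET CHARACTERS» `LiTheory.LiZeroWindowEchoDirichlet`, L-P(P1χ); cell `pub/rh-li`, dossier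
`theory/route/p5`), item `LiHorizontalEdgesChar` (stmt-RiemannHypothesis-19401): for a primitive `χ` mod `q > 1` and every
`c ≥ 1` there are `N`, `C = C(q)` such that for `n ≥ N` and every `T ∈ [√n, c√n]` there is a GOOD height `T' ∈ [T, T + 1]`
— no zero of `ξ(·, χ)` on the segment `[−1/2, 3/2] × {T'}` — with `|charHorizTerm χ n T'| ≤ C log² n`.

Proof (the ζ template `Theorems/LiPrimeEchoHorizontalEdges.lean` of the CLOSED route LiPrimeEcho with the tree's
character inputs): F₁χ good heights for `L(s, χ)` (`ExplicitPsiChar.exists_goodHeight`, MV Lemma 12.7: `T' ∈ [T, T+1]` at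
distance `≥ c₀/(log q + log(T'+4))` from every ordinate `|Im ρ|`), with the bookkeeping
`(log q + log(T'+4))/η ≤ A(q) log² n` once `√n ≥ c + 5`; F₂χ the segment bound
`|ξ'/ξ(σ + iT', χ)| ≤ C(log q + log(T'+4))/η` on `σ ∈ [−1/2, 3/2]` — for `σ > 0` from
`ξ'/ξ = ½ log q + Γ_ℝ'/Γ_ℝ(s + a) + L'/L` (`DirichletTheta.logDeriv_dirichletXi_eq`) with the strip bound
`ExplicitPsiChar.exists_norm_logDeriv_LFunction_le_strip` and `norm_logDeriv_Gammaℝ_le_of_mem_Icc`, for `σ ≤ 0` by the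
reflection `ξ'/ξ(s, χ) = −conj ξ'/ξ(1 − s̄, χ)` (`logDeriv_dirichletXi_one_sub_conj`) — times `|F_n(σ + iT')| ≤ e`
(`HorizontalEdges.norm_liWeight_le_exp`), segment length `2`; and no zero of `ξ(·, χ)` on the segment since such a zero is
a non-trivial zero of `L(s, χ)` at ordinate `T'`.  Nothing about the position of the zeros is used; nothing here bears on
the truth of RH or GRH.
-/

noncomputable section

-- D-0017: `Summit.<S>.<S>.…` is the designed namespace of a single-problem summit.
set_option linter.dupNamespace false

open Complex MeasureTheory intervalIntegral Set
open scoped Interval ComplexConjugate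

namespace Summit.RiemannHypothesis.RiemannHypothesis.Theorems.LiTheory

open Literature.NumberTheory.LFunctions Literature.NumberTheory.LFunctions.DirichletTheta
  Literature.NumberTheory.LFunctions.ExplicitPsiChar

namespace HorizontalEdgesChar

open HorizontalEdges

variable {q : ℕ} [NeZero q] {χ : DirichletCharacter ℂ q}

/-- **`ξ'/ξ(·, χ)` on the segment `[−1/2, 3/2] × {t}` at a separated height** (primitive `χ` mod `q > 1`): there is an
absolute `C ≥ 0` such that for `|t| ≥ 2`, `0 < η ≤ 1` with every non-trivial zero at distance `≥ η` from the ordinate `t`,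
and every `σ ∈ [−1/2, 3/2]`: `‖ξ'/ξ(σ + it, χ)‖ ≤ C (log q + log(|t| + 4))/η`. -/
theorem exists_norm_logDeriv_dirichletXi_le :
    ∃ C : ℝ, 0 ≤ C ∧ ∀ (q : ℕ) [NeZero q] (χ : DirichletCharacter ℂ q), χ.IsPrimitive → 1 < q →
      ∀ t η : ℝ, 2 ≤ |t| → 0 < η → η ≤ 1 →
        (∀ ρ : ℂ, χ.LFunction ρ = 0 → 0 < ρ.re → ρ.re < 1 → η ≤ |ρ.im - t|) →
        ∀ σ : ℝ, σ ∈ Icc (-(1 / 2) : ℝ) (3 / 2) →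
          ‖logDeriv (dirichletXi χ) (σ + t * I)‖ ≤ C * (Real.log q + Real.log (|t| + 4)) / η := by
  obtain ⟨C, hC0, hC⟩ := exists_norm_logDeriv_LFunction_le_strip
  refine ⟨C + 7, by positivity, fun q _ χ hχ hq t η ht hη hη1 hZ σ hσ ↦ ?_⟩
  have h1 : χ ≠ 1 := ne_one_of_isPrimitive hχ hq
  set ℒ : ℝ := Real.log q + Real.log (|t| + 4) with hℒ
  have hℒ1 : 1 ≤ ℒ := DirichletZFR.one_le_ell q t
  have hq1 : (1 : ℝ) ≤ q := by exact_mod_cast NeZero.one_le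
  have hlogq : 0 ≤ Real.log q := Real.log_nonneg hq1
  have hlog4 : 0 ≤ Real.log (|t| + 4) := Real.log_nonneg (by linarith [abs_nonneg t])
  have ha0 : (0 : ℝ) ≤ charParity χ := Nat.cast_nonneg _
  have ha1 : (charParity χ : ℝ) ≤ 1 := by exact_mod_cast charParity_le_one χ
  -- the direct bound on `0 < σ' ≤ 3/2`
  have direct : ∀ σ' : ℝ, 0 < σ' → σ' ≤ 3 / 2 →
      ‖deriv (dirichletXi χ) (σ' + t * I) / dirichletXi χ (σ' + t * I)‖ ≤
        Real.log q / 2 + (Real.log (|t| + 4) / 2 + 6) + C * ℒ / η := by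
    intro σ' h0 h32
    obtain ⟨hL0, hLb⟩ := hC q χ hχ hq t η ht hη hη1 hZ σ' ⟨by linarith, h32⟩
    have hre : (0 : ℝ) < ((σ' : ℂ) + t * I).re := by simp; exact h0
    rw [logDeriv_dirichletXi_eq h1 hre hL0]
    have hΓ : ‖logDeriv Gammaℝ ((σ' : ℂ) + t * I + (charParity χ : ℂ))‖ ≤ Real.log (|t| + 4) / 2 + 6 := by
      have e : ((σ' : ℂ) + t * I + (charParity χ : ℂ)) = (((σ' + charParity χ : ℝ)) : ℂ) + t * I := by
        push_cast; ring
      rw [e]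
      exact norm_logDeriv_Gammaℝ_le_of_mem_Icc (by linarith) (by linarith) ht
    have hq2 : ‖(Real.log q : ℂ) / 2‖ = Real.log q / 2 := by
      rw [norm_div, Complex.norm_real, Complex.norm_two, Real.norm_eq_abs, abs_of_nonneg hlogq]
    calc ‖(Real.log q : ℂ) / 2 + logDeriv Gammaℝ ((σ' : ℂ) + t * I + (charParity χ : ℂ))
          + logDeriv χ.LFunction ((σ' : ℂ) + t * I)‖
        ≤ ‖(Real.log q : ℂ) / 2 + logDeriv Gammaℝ ((σ' : ℂ) + t * I + (charParity χ : ℂ))‖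
          + ‖logDeriv χ.LFunction ((σ' : ℂ) + t * I)‖ := norm_add_le _ _
      _ ≤ (‖(Real.log q : ℂ) / 2‖ + ‖logDeriv Gammaℝ ((σ' : ℂ) + t * I + (charParity χ : ℂ))‖)
          + C * ℒ / η := add_le_add (norm_add_le _ _) hLb
      _ ≤ (Real.log q / 2 + (Real.log (|t| + 4) / 2 + 6)) + C * ℒ / η := by rw [hq2]; gcongr
  -- both cases
  have hmain : ‖logDeriv (dirichletXi χ) (σ + t * I)‖ ≤
      Real.log q / 2 + (Real.log (|t| + 4) / 2 + 6) + C * ℒ / η := by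
    rw [logDeriv_apply]
    rcases lt_or_ge 0 σ with hpos | hnonpos
    · exact direct σ hpos hσ.2
    · -- reflect: `σ + it = 1 − conj((1 − σ) + it)`
      have e : ((σ : ℂ) + t * I) = 1 - conj ((((1 - σ : ℝ)) : ℂ) + t * I) := by
        apply Complex.ext
        · simp
        · simp
      rw [e, logDeriv_dirichletXi_one_sub_conj hχ h1, norm_neg, Complex.norm_conj]
      exact direct (1 - σ) (by linarith) (by linarith [hσ.1])
  refine hmain.trans ?_
  -- `log q/2 + log(|t|+4)/2 + 6 + Cℒ/η ≤ (C + 7)ℒ/η`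
  have hℒη : ℒ ≤ ℒ / η := by
    rw [le_div_iff₀ hη]; nlinarith
  have h7 : Real.log q / 2 + (Real.log (|t| + 4) / 2 + 6) ≤ 7 * (ℒ / η) := by
    have : Real.log q / 2 + (Real.log (|t| + 4) / 2 + 6) ≤ 7 * ℒ := by rw [hℒ]; linarith
    exact this.trans (by linarith)
  have e : (C + 7) * ℒ / η = C * ℒ / η + 7 * (ℒ / η) := by ring
  rw [e]
  linarith

/-- **F₂χ (segment bound at a separated height).**  There is an absolute `C ≥ 0` such that for primitive `χ` mod `q > 1`,
`T ≥ 2`, `T ≥ √n`, `0 < η ≤ 1` with every non-trivial zero of `L(s, χ)` at distance `≥ η` from the ordinate `T`: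
`T ∈ charGoodHeights χ` and `|charHorizTerm χ n T| ≤ C (log q + log(|T| + 4))/η`. -/
theorem horiz_pointwise :
    ∃ C : ℝ, 0 ≤ C ∧ ∀ (q : ℕ) [NeZero q] (χ : DirichletCharacter ℂ q), χ.IsPrimitive → 1 < q →
      ∀ (n : ℕ) (T η : ℝ), 2 ≤ T → Real.sqrt n ≤ T → 0 < η → η ≤ 1 →
      (∀ ρ : ℂ, χ.LFunction ρ = 0 → 0 < ρ.re → ρ.re < 1 → η ≤ |ρ.im - T|) →
        T ∈ charGoodHeights χ ∧ |charHorizTerm χ n T| ≤ C * (Real.log q + Real.log (|T| + 4)) / η := by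
  -- adapted from `HorizontalEdges.horiz_pointwise` (Theorems/LiPrimeEchoHorizontalEdges.lean, route LiPrimeEcho)
  obtain ⟨C, hC, hseg⟩ := exists_norm_logDeriv_dirichletXi_le
  refine ⟨2 * C, by positivity, fun q _ χ hχ hq n T η hT2 hTn hη0 hη1 hZ ↦ ?_⟩
  have h1 : χ ≠ 1 := ne_one_of_isPrimitive hχ hq
  have hT0 : 0 < T := by linarith
  have hTabs : 2 ≤ |T| := by rw [abs_of_pos hT0]; exact hT2
  have hseg' := hseg q χ hχ hq T η hTabs hη0 hη1 hZ
  have hq1 : (1 : ℝ) ≤ q := by exact_mod_cast NeZero.one_le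
  have hlogq : 0 ≤ Real.log q := Real.log_nonneg hq1
  have hlog0 : 0 ≤ Real.log (|T| + 4) := Real.log_nonneg (by linarith [abs_nonneg T])
  have hnT : (n : ℝ) ≤ T ^ 2 := by
    have h := Real.sq_sqrt (n.cast_nonneg : (0 : ℝ) ≤ n)
    nlinarith [Real.sqrt_nonneg (n : ℝ)]
  constructor
  · -- no zero of `ξ(·, χ)` on the segment
    intro x _ h0
    have hmem := (dirichletXi_eq_zero_iff_mem_charNontrivialZeros hχ h1 _).1 h0
    obtain ⟨hL, hre, hre1⟩ := mem_charNontrivialZeros.1 hmem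
    have h := hZ _ hL hre hre1
    simp at h
    linarith
  · -- the segment integral
    set K : ℝ := C * (Real.log q + Real.log (|T| + 4)) / η with hK
    have hK0 : 0 ≤ K := by positivity
    have hpt : ∀ x ∈ Ι (-(1 / 2 : ℝ)) (3 / 2),
        ‖logDeriv (dirichletXi χ) (x + T * I) * liWeight n (x + T * I)‖ ≤ K * Real.exp 1 := by
      intro x hx
      rw [uIoc_of_le (by norm_num)] at hx
      rw [norm_mul]
      exact mul_le_mul (hseg' x ⟨hx.1.le, hx.2⟩) (norm_liWeight_le_exp n hx.1.le hT0 hnT) (norm_nonneg _) hK0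
    have hI := intervalIntegral.norm_integral_le_of_norm_le_const hpt
    have hlen : |(3 / 2 : ℝ) - -(1 / 2)| = 2 := by norm_num
    rw [hlen] at hI
    unfold charHorizTerm
    rw [abs_mul, abs_of_pos (by positivity : (0 : ℝ) < 1 / Real.pi)]
    have him := Complex.abs_im_le_norm
      (∫ x in (-(1 / 2 : ℝ))..(3 / 2 : ℝ), logDeriv (dirichletXi χ) (x + T * I) * liWeight n (x + T * I))
    have hπ : 1 / Real.pi ≤ 1 / 3 := one_div_le_one_div_of_le (by norm_num) Real.pi_gt_three.le
    have he : Real.exp 1 < 3 := lt_trans Real.exp_one_lt_d9 (by norm_num)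
    calc 1 / Real.pi * |(∫ x in (-(1 / 2 : ℝ))..(3 / 2 : ℝ),
            logDeriv (dirichletXi χ) (x + T * I) * liWeight n (x + T * I)).im|
        ≤ 1 / 3 * (K * Real.exp 1 * 2) := mul_le_mul hπ (him.trans hI) (abs_nonneg _) (by norm_num)
      _ ≤ 2 * C * (Real.log q + Real.log (|T| + 4)) / η := by
          rw [show 2 * C * (Real.log q + Real.log (|T| + 4)) / η = K * 2 by rw [hK]; ring]
          nlinarith

/-- **F₁χ (good heights for `L(s, χ)` with the log bookkeeping).**  For primitive `χ` mod `q > 1` and `c ≥ 1` there are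
`N`, `A` such that for `n ≥ N` and `√n ≤ T ≤ c√n` some `T' ∈ [T, T+1]` and `η ∈ (0, 1]` satisfy
`(log q + log(|T'| + 4))/η ≤ A log² n` and separate `T'` by `η` from the ordinate of every non-trivial zero of `L(s, χ)`
(Montgomery–Vaughan Lemma 12.7). -/
theorem goodHeight_log (hχ : χ.IsPrimitive) (hq : 1 < q) :
    ∀ c : ℝ, 1 ≤ c → ∃ N : ℕ, ∃ A : ℝ, ∀ n : ℕ, N ≤ n → ∀ T : ℝ, Real.sqrt n ≤ T → T ≤ c * Real.sqrt n →
      ∃ T' η : ℝ, T ≤ T' ∧ T' ≤ T + 1 ∧ 0 < η ∧ η ≤ 1 ∧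
        (Real.log q + Real.log (|T'| + 4)) / η ≤ A * Real.log n ^ 2 ∧
        ∀ ρ : ℂ, χ.LFunction ρ = 0 → 0 < ρ.re → ρ.re < 1 → η ≤ |ρ.im - T'| := by
  -- adapted from `HorizontalEdges.goodHeight_log` (Theorems/LiPrimeEchoHorizontalEdges.lean, route LiPrimeEcho)
  intro c hc
  obtain ⟨c₀, hc₀, hgh⟩ := exists_goodHeight
  set Lq : ℝ := 1 + Real.log q with hLq
  have hq1 : (1 : ℝ) ≤ q := by exact_mod_cast NeZero.one_le
  have hlogq : 0 ≤ Real.log q := Real.log_nonneg hq1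
  have hLq1 : 1 ≤ Lq := by rw [hLq]; linarith
  refine ⟨⌈(c + 5) ^ 2⌉₊, Lq * (1 + Lq / c₀), fun n hn T hT1 hT2 ↦ ?_⟩
  -- sizes
  have hc5 : (c + 5) ^ 2 ≤ (n : ℝ) := (Nat.le_ceil _).trans (by exact_mod_cast hn)
  set s := Real.sqrt n with hs
  have hn0 : (0 : ℝ) ≤ n := by positivity
  have hss : s ^ 2 = n := by rw [hs, Real.sq_sqrt hn0]
  have hs6 : c + 5 ≤ s := by
    rw [hs, ← Real.sqrt_sq (by linarith : 0 ≤ c + 5)]; exact Real.sqrt_le_sqrt hc5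
  have hs0 : 0 < s := by linarith
  have hT0 : 0 ≤ T := by linarith
  obtain ⟨T₁, ⟨hT₁l, hT₁u⟩, hsep⟩ := hgh q χ hχ hq T hT0
  have hT₁0 : 0 ≤ T₁ := hT0.trans hT₁l
  set ℒ : ℝ := Real.log q + Real.log (|T₁| + 4) with hℒ
  have hℒ1 : 1 ≤ ℒ := DirichletZFR.one_le_ell q T₁
  have hℒ0 : 0 < ℒ := by linarith
  set η : ℝ := min 1 (c₀ / ℒ) with hη
  have hη0 : 0 < η := lt_min one_pos (div_pos hc₀ hℒ0)
  have hη1 : η ≤ 1 := min_le_left _ _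
  have hηsep : η ≤ c₀ / ℒ := min_le_right _ _
  refine ⟨T₁, η, hT₁l, hT₁u, hη0, hη1, ?_, fun ρ hL hre hre1 ↦ ?_⟩
  · -- `ℒ/η ≤ Lq(1 + Lq/c₀) log² n`
    have htop : T₁ + 4 ≤ n := by
      have : (c + 5) * s ≤ s * s := mul_le_mul_of_nonneg_right hs6 hs0.le
      nlinarith
    have hn36 : (36 : ℝ) ≤ n := by nlinarith
    have hlogn1 : 1 ≤ Real.log n := by
      rw [Real.le_log_iff_exp_le (by linarith)]
      have := Real.exp_one_lt_d9; linarith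
    have hl4 : Real.log (|T₁| + 4) ≤ Real.log n := by
      rw [abs_of_nonneg hT₁0]; exact Real.log_le_log (by linarith) htop
    have hℒle : ℒ ≤ Lq * Real.log n := by
      rw [hℒ, hLq]
      nlinarith
    -- `1/η ≤ 1 + ℒ/c₀`
    have hinv : 1 / η ≤ 1 + ℒ / c₀ := by
      rw [hη]
      rcases le_total 1 (c₀ / ℒ) with h | h
      · rw [min_eq_left h]; have : 0 ≤ ℒ / c₀ := by positivity
        linarith
      · rw [min_eq_right h, one_div_div]
        linarith
    have hLn : 0 ≤ Lq * Real.log n := by positivity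
    calc ℒ / η = ℒ * (1 / η) := by ring
      _ ≤ (Lq * Real.log n) * (1 + (Lq * Real.log n) / c₀) := by
          refine mul_le_mul hℒle (hinv.trans ?_) (by positivity) hLn
          gcongr
      _ ≤ Lq * (1 + Lq / c₀) * Real.log n ^ 2 := by
          have h1 : (1 : ℝ) ≤ Real.log n := hlogn1
          have e : Lq * (1 + Lq / c₀) * Real.log n ^ 2
              = (Lq * Real.log n) * (Real.log n + (Lq * Real.log n) / c₀) := by ring
          rw [e]
          refine mul_le_mul_of_nonneg_left ?_ hLn
          gcongr
  · -- separation: `η ≤ c₀/ℒ ≤ ||Im ρ| − T₁| ≤ |Im ρ − T₁|`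
    have h := hsep ρ hL hre hre1
    have htri : |(|ρ.im|) - T₁| ≤ |ρ.im - T₁| := by
      rcases le_or_gt 0 ρ.im with hi | hi
      · rw [abs_of_nonneg hi]
      · rw [abs_of_neg hi]
        rw [abs_le]
        constructor
        · have := neg_abs_le (ρ.im - T₁); have h2 := abs_sub_comm ρ.im T₁; nlinarith [abs_nonneg (ρ.im - T₁)]
        · have : -ρ.im - T₁ ≤ T₁ - ρ.im := by linarith
          exact this.trans (by rw [abs_sub_comm]; exact le_abs_self _)
    exact hηsep.trans (h.trans htri)

end HorizontalEdgesChar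

open HorizontalEdgesChar in
/-- **Crux K3χ `LiHorizontalEdgesChar` of route `LiDirichletEcho`** (stmt-RiemannHypothesis-19401; RH-FREE, GRH-FREE):
for primitive `χ` mod `q > 1` and `c ≥ 1` there are `N`, `C` with: for `n ≥ N` and `T ∈ [√n, c√n]` some good height
`T' ∈ [T, T+1]` has `|charHorizTerm χ n T'| ≤ C log² n`. -/
theorem liHorizontalEdgesChar_bound {q : ℕ} [NeZero q] (χ : DirichletCharacter ℂ q) (hχ : χ.IsPrimitive)
    (hq : 1 < q) :
    ∀ c : ℝ, 1 ≤ c → ∃ N : ℕ, ∃ C : ℝ, ∀ n : ℕ, N ≤ n → ∀ T : ℝ, Real.sqrt n ≤ T → T ≤ c * Real.sqrt n →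
      ∃ T' : ℝ, T ≤ T' ∧ T' ≤ T + 1 ∧ T' ∈ charGoodHeights χ ∧ |charHorizTerm χ n T'| ≤ C * Real.log n ^ 2 := by
  intro c hc
  obtain ⟨N, A, hN⟩ := goodHeight_log hχ hq c hc
  obtain ⟨C, hC0, hP⟩ := horiz_pointwise
  refine ⟨max N 4, C * A, fun n hn T hT1 hT2 ↦ ?_⟩
  have hnN : N ≤ n := le_trans (le_max_left _ _) hn
  have hn4 : (4 : ℝ) ≤ n := by exact_mod_cast le_trans (le_max_right _ _) hn
  have hs2 : 2 ≤ Real.sqrt n := by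
    have : Real.sqrt 4 = 2 := by
      rw [show (4 : ℝ) = 2 ^ 2 by norm_num]; exact Real.sqrt_sq (by norm_num)
    rw [← this]; exact Real.sqrt_le_sqrt hn4
  obtain ⟨T', η, hTT', hT'1, hη0, hη1, hlog, hsep⟩ := hN n hnN T hT1 hT2
  obtain ⟨hgood, hbd⟩ := hP q χ hχ hq n T' η (by linarith) (by linarith) hη0 hη1 hsep
  refine ⟨T', hTT', hT'1, hgood, hbd.trans ?_⟩
  rw [mul_div_assoc, mul_assoc]
  exact mul_le_mul_of_nonneg_left hlog hC0

/-- **Item `LiHorizontalEdgesChar` of route `LiDirichletEcho`** (stmt-RiemannHypothesis-19401), closed BY NAME. -/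
theorem liHorizontalEdgesChar_proof :
    Summit.RiemannHypothesis.RiemannHypothesis.Theses.LiDirichletEcho.LiHorizontalEdgesChar :=
  fun _ _ χ hχ hq ↦ liHorizontalEdgesChar_bound χ hχ hq

end Summit.RiemannHypothesis.RiemannHypothesis.Theorems.LiTheory

end
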